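import Mathlib
import Literature.NumberTheory.LFunctions.Zhang2022.RepairBedClassNumberFormula
import Literature.NumberTheory.QuadraticFields.RealQuadraticFundamentalUnitValues
import Literature.NumberTheory.QuadraticFields.RealQuadraticRegulatorLowerBound
import HarnessLib

/-!
# Zhang (2022), rescue bed (D-0124 (3)) honesty rule H2 as a kernel fact: Assumption (A) is FALSE at the
# bed's genuine moduli — every (A)-guarded node is vacuous on genuine data

Topic `Literature/NumberTheory/LFunctions/Zhang2022` (Landau–Siegel audit tree; verdict-neutral).
Y. Zhang, *Discrete mean estimates and the Landau–Siegel zero*, arXiv:2211.02515v1 (2022)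
[Zhang2022LandauSiegel] — **an unrefereed manuscript under adjudication; nothing in this file asserts or
denies its Theorems 1–2, and nothing here is a claim about Landau–Siegel zeros. The programme SEARCHES and
TYPES; no claim about Landau–Siegel zeros, Theorems 1–2 of arXiv:2211.02515 or a repaired Margin232 until a
kernel theorem says so.**

Purpose. The rescue BED's honesty rule (BED §0.2 (H2)) says: `AssumptionA D χ := ‖L(1,χ)‖ < 1/(log D)^2022`
(`Skeleton.AssumptionA`) is FALSE for every real primitive character an engine can reach, hence every
(A)-GUARDED node ((2.32)/(2.33)/(8.23)/(9.7)/(10.17)/(11.1)/(18.3)) holds VACUOUSLY at every bed modulus and no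
bed row «node verified/violated at D» can exist. The books cite the desk's prose (N2) for this. Here it is a
theorem at the bed's genuine characters `χ_D = kroneckerChar D` (Tier S moduli `−4, 5, −163`; bed-1 lists
`L1a`/`L1b`), from the tree's kernel class-number-formula values `Repair.Bed.LOne_*`
(`RepairBedClassNumberFormula`, typ-1) and one elementary estimate:

* (private helpers) for `D ≥ 3`, `1/(log D)^2022 ≤ 1/54` (`log 3 ≥ log 2 + 1/3 > 1.0264`, Bernoulli);
* `not_assumptionA_of_re_ge` — for ANY character `χ (mod D)`, `D ≥ 3`: `Re L(1,χ) ≥ 1/54 → ¬ AssumptionA D χ`;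
* `LOne_eq_re` — the bridge `LOne D = Re L(1, kroneckerChar D)`; `not_assumptionA_kroneckerChar_of_LOne_ge`;
* instances: `not_assumptionA_kroneckerChar_neg4` (`L(1,χ₋₄) = π/4`), `…_neg3` (`π/(3√3)`),
  `…_of_mem_classNumberOne` (`D ∈ {−7, −8, −11, −19, −43, −67, −163}`, `L = π/√|D|`), `…_neg15/neg20/neg23/neg24`,
  `…_neg1155`, `…_neg77683` (the bed-1 deep rung), and the real Tier-S modulus `…_five`
  (`L(1,χ₅) = 2 log((1+√5)/2)/√5`).

* (rev 2, append) the POSITIVE moduli `8, 12, 13, 17, 21, 24, 28, 29, 1365` via `L = 2 h_K R_K/√D ≥ 2 log ε_D/√D`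
  (`Quadratic.regulator_of_discr_eq_*`), and the package `not_assumptionA_bed12S_moduli` (all eleven Tier-S moduli).
* (rev 3, append) UNIFORM ranges: `not_assumptionA_kroneckerChar_of_neg` (every fundamental `−28 000 ≤ D < −4`,
  via `h(D) ≥ 1`) and `not_assumptionA_kroneckerChar_of_pos` (every fundamental `0 < D ≤ 1 600`, via `R_K ≥ log((1+√5)/2)`).
* (rev 4, append) the ranges pushed to `|D| ≤ 10¹²` (`(log|D|)^2022 ≥ (log 5)^32 > 2.5·10⁶`):
  `not_assumptionA_of_re_ge_small`, `not_assumptionA_kroneckerChar_of_neg_le_1e12`, `…_of_pos_le_1e12` — (A) is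
  refuted in the kernel at every real primitive character of conductor `≤ 10¹²`.
* (rev 5, append) the one-decl package `not_assumptionA_kroneckerChar_of_natAbs_le_1e12` (every fundamental `|D| ≤ 10¹²`).

So at every modulus the bed's Tier S / Tier G1 rows use, `AssumptionA |D| χ_D` is refuted in the kernel; the
(A)-defect numbers of bed-1 (G06) quantify by how much. No definition, no named fact; no statement about (A) at
large `D`, which is the manuscript's subject.

## References

* Y. Zhang, arXiv:2211.02515v1 (2022), §2 Assumption (A) p. 4. [cite: Zhang2022LandauSiegel, §2 Assumption (A)]
* H. Davenport, *Multiplicative Number Theory*, 2nd ed. (1980), Ch. 6 (class number formula). [cite: DavenportMNT1980, Ch. 6]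
-/

noncomputable section

open Complex Real

namespace Literature.NumberTheory.LFunctions.Zhang2022.Repair.Bed.Vacuity

open Skeleton Literature.NumberTheory.LFunctions.Zhang2022.Repair.Bed
open Literature.NumberTheory.LFunctions.KroneckerCharacter
open Literature.NumberTheory.QuadraticFields

/-! ## The elementary estimate -/

/-- `log 3 ≥ 1.0264` (`log 3 = log 2 + log (3/2)`, `log 2 > 0.6931471803`, `log (3/2) ≥ 1 − 2/3`). [folklore] -/
private theorem log_three_ge : (1.0264 : ℝ) ≤ Real.log 3 := by
  have h2 := Real.log_two_gt_d9
  have h32 : (1 : ℝ) - (3 / 2 : ℝ)⁻¹ ≤ Real.log (3 / 2) := Real.one_sub_inv_le_log_of_pos (by norm_num)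
  have : Real.log 3 = Real.log 2 + Real.log (3 / 2) := by
    rw [← Real.log_mul (by norm_num) (by norm_num)]; norm_num
  rw [this]; norm_num at h32 ⊢; linarith

/-- **For `D ≥ 3`: `1/(log D)^2022 ≤ 1/54`** (`(log D)^2022 ≥ (1.0264)^2022 ≥ 1 + 2022·0.0264 > 54`, Bernoulli).
[folklore] -/
private theorem one_div_log_pow_le {D : ℕ} (hD : 3 ≤ D) : 1 / Real.log D ^ 2022 ≤ (1 : ℝ) / 54 := by
  have h3 : Real.log 3 ≤ Real.log D :=
    Real.log_le_log (by norm_num) (by exact_mod_cast hD)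
  have hlog : (1.0264 : ℝ) ≤ Real.log D := le_trans log_three_ge h3
  -- Bernoulli on the abstract base `log D = 1 + (log D − 1)` (no numeral is raised to the 2022nd power)
  have hB : (1 : ℝ) + (2022 : ℕ) * (Real.log D - 1) ≤ (1 + (Real.log D - 1)) ^ 2022 :=
    one_add_mul_le_pow (by linarith) 2022
  have heq : (1 : ℝ) + (Real.log D - 1) = Real.log D := by ring
  rw [heq] at hB
  have h54 : (54 : ℝ) ≤ Real.log D ^ 2022 := by
    have : (54 : ℝ) ≤ 1 + (2022 : ℕ) * (Real.log D - 1) := by push_cast; linarith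
    exact le_trans this hB
  rw [div_le_div_iff₀ (by linarith) (by norm_num)]
  linarith

/-! ## The generic refutation -/

/-- **`Re L(1,χ) ≥ 1/54` refutes Assumption (A) at any modulus `D ≥ 3`**, for ANY Dirichlet character `χ (mod D)`:
`‖L(1,χ)‖ ≥ Re L(1,χ) ≥ 1/54 ≥ 1/(log D)^2022`. [cite: Zhang2022LandauSiegel, §2 Assumption (A)] -/
theorem not_assumptionA_of_re_ge {D : ℕ} [NeZero D] (χ : DirichletCharacter ℂ D) (hD : 3 ≤ D)
    (h : (1 : ℝ) / 54 ≤ (χ.LFunction 1).re) : ¬ AssumptionA D χ := by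
  intro hA
  unfold AssumptionA at hA
  have hre : (χ.LFunction 1).re ≤ ‖χ.LFunction 1‖ := Complex.re_le_norm _
  have hlog := one_div_log_pow_le hD
  linarith

/-- The bridge to the bed's object: for `D ≠ 0`, `LOne D = Re L(1, kroneckerChar D)` (`Repair.Bed.LOne` unfolds to
exactly this; the `NeZero |D|` instance is built in-term as there). [cite: DavenportMNT1980, Ch. 6] -/
theorem LOne_eq_re {D : ℤ} (h : D ≠ 0) :
    LOne D = (haveI : NeZero D.natAbs := ⟨Int.natAbs_ne_zero.mpr h⟩; ((kroneckerChar D).LFunction 1).re) := by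
  rw [LOne, dif_neg h]

/-- **`LOne D ≥ 1/54` refutes (A) at the genuine character `χ_D = kroneckerChar D`** (`|D| ≥ 3`).
[cite: Zhang2022LandauSiegel, §2 Assumption (A)] -/
theorem not_assumptionA_kroneckerChar_of_LOne_ge {D : ℤ} (h0 : D ≠ 0) (h3 : 3 ≤ D.natAbs)
    (hL : (1 : ℝ) / 54 ≤ LOne D) :
    haveI : NeZero D.natAbs := ⟨Int.natAbs_ne_zero.mpr h0⟩
    ¬ AssumptionA D.natAbs (kroneckerChar D) := by
  haveI : NeZero D.natAbs := ⟨Int.natAbs_ne_zero.mpr h0⟩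
  refine not_assumptionA_of_re_ge _ h3 ?_
  rw [LOne_eq_re h0] at hL
  exact hL

/-! ## The bed moduli -/

/-- `1/54 ≤ π/c` for `0 < c ≤ 160` (`π > 3`, `160/54 < 3`). [folklore] -/
private theorem one_div_le_pi_div {c : ℝ} (hc : 0 < c) (hc' : c ≤ 160) : (1 : ℝ) / 54 ≤ Real.pi / c := by
  rw [div_le_div_iff₀ (by norm_num) hc]
  nlinarith [Real.pi_gt_three]

/-- **(A) is false at `D = −4`** (`L(1, χ₋₄) = π/4`, `LOne_neg4`): the Tier-S modulus `−4` of bed12-S.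
[cite: Zhang2022LandauSiegel, §2 Assumption (A)] [cite: DavenportMNT1980, Ch. 6] -/
theorem not_assumptionA_kroneckerChar_neg4 :
    haveI : NeZero (-4 : ℤ).natAbs := ⟨by decide⟩
    ¬ AssumptionA (-4 : ℤ).natAbs (kroneckerChar (-4)) :=
  not_assumptionA_kroneckerChar_of_LOne_ge (by norm_num) (by decide)
    (by rw [LOne_neg4]; exact one_div_le_pi_div (by norm_num) (by norm_num))

/-- **(A) is false at `D = −3`** (`L(1, χ₋₃) = π/(3√3)`, `LOne_neg3`; `3√3 ≤ 6`).
[cite: Zhang2022LandauSiegel, §2 Assumption (A)] [cite: DavenportMNT1980, Ch. 6] -/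
theorem not_assumptionA_kroneckerChar_neg3 :
    haveI : NeZero (-3 : ℤ).natAbs := ⟨by decide⟩
    ¬ AssumptionA (-3 : ℤ).natAbs (kroneckerChar (-3)) := by
  refine not_assumptionA_kroneckerChar_of_LOne_ge (by norm_num) (by decide) ?_
  rw [LOne_neg3]
  have hs : Real.sqrt 3 ≤ 2 := by
    rw [show (2 : ℝ) = Real.sqrt 4 by rw [show (4:ℝ) = 2 ^ 2 by norm_num, Real.sqrt_sq (by norm_num)]]
    exact Real.sqrt_le_sqrt (by norm_num)
  have hs0 : 0 < Real.sqrt 3 := Real.sqrt_pos.mpr (by norm_num)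
  exact one_div_le_pi_div (by positivity) (by nlinarith)

/-- **(A) is false at the seven class-number-one bed moduli `D ∈ {−7, −8, −11, −19, −43, −67, −163}`**
(`L(1, χ_D) = π/√|D|`, `LOne_eq_pi_div_sqrt_of_mem`; `√|D| ≤ √163 < 13`): includes the Tier-S modulus `−163`.
[cite: Zhang2022LandauSiegel, §2 Assumption (A)] [cite: DavenportMNT1980, Ch. 6] -/
theorem not_assumptionA_kroneckerChar_of_mem_classNumberOne {D : ℤ}
    (hD : D ∈ ([-7, -8, -11, -19, -43, -67, -163] : List ℤ)) :
    ∃ h0 : D ≠ 0, haveI : NeZero D.natAbs := ⟨Int.natAbs_ne_zero.mpr h0⟩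
      ¬ AssumptionA D.natAbs (kroneckerChar D) := by
  have hL := LOne_eq_pi_div_sqrt_of_mem hD
  simp only [List.mem_cons, List.not_mem_nil, or_false] at hD
  have h0 : D ≠ 0 := by rcases hD with rfl | rfl | rfl | rfl | rfl | rfl | rfl <;> norm_num
  have h3 : 3 ≤ D.natAbs := by rcases hD with rfl | rfl | rfl | rfl | rfl | rfl | rfl <;> decide
  have habs : |(D : ℝ)| ≤ 163 := by
    rcases hD with rfl | rfl | rfl | rfl | rfl | rfl | rfl <;> norm_num
  have habs0 : 0 < |(D : ℝ)| := by
    rcases hD with rfl | rfl | rfl | rfl | rfl | rfl | rfl <;> norm_num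
  refine ⟨h0, not_assumptionA_kroneckerChar_of_LOne_ge h0 h3 ?_⟩
  rw [hL]
  have hs : Real.sqrt |(D : ℝ)| ≤ 13 := by
    rw [show (13 : ℝ) = Real.sqrt 169 by rw [show (169:ℝ) = 13 ^ 2 by norm_num, Real.sqrt_sq (by norm_num)]]
    exact Real.sqrt_le_sqrt (by linarith)
  exact one_div_le_pi_div (Real.sqrt_pos.mpr habs0) (by linarith)

/-- **(A) is false at `D = −15, −20, −23, −24`** (`L = 2π/√15, 2π/√20, 3π/√23, 2π/√24`; bed-1 list `L1b`).
[cite: Zhang2022LandauSiegel, §2 Assumption (A)] [cite: DavenportMNT1980, Ch. 6] -/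
theorem not_assumptionA_kroneckerChar_neg15_20_23_24 :
    (haveI : NeZero (-15 : ℤ).natAbs := ⟨by decide⟩; ¬ AssumptionA (-15 : ℤ).natAbs (kroneckerChar (-15))) ∧
    (haveI : NeZero (-20 : ℤ).natAbs := ⟨by decide⟩; ¬ AssumptionA (-20 : ℤ).natAbs (kroneckerChar (-20))) ∧
    (haveI : NeZero (-23 : ℤ).natAbs := ⟨by decide⟩; ¬ AssumptionA (-23 : ℤ).natAbs (kroneckerChar (-23))) ∧
    (haveI : NeZero (-24 : ℤ).natAbs := ⟨by decide⟩; ¬ AssumptionA (-24 : ℤ).natAbs (kroneckerChar (-24))) := by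
  have s15 : Real.sqrt 15 ≤ 5 := by
    rw [show (5 : ℝ) = Real.sqrt 25 by rw [show (25:ℝ) = 5 ^ 2 by norm_num, Real.sqrt_sq (by norm_num)]]
    exact Real.sqrt_le_sqrt (by norm_num)
  have s20 : Real.sqrt 20 ≤ 5 := by
    rw [show (5 : ℝ) = Real.sqrt 25 by rw [show (25:ℝ) = 5 ^ 2 by norm_num, Real.sqrt_sq (by norm_num)]]
    exact Real.sqrt_le_sqrt (by norm_num)
  have s23 : Real.sqrt 23 ≤ 5 := by
    rw [show (5 : ℝ) = Real.sqrt 25 by rw [show (25:ℝ) = 5 ^ 2 by norm_num, Real.sqrt_sq (by norm_num)]]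
    exact Real.sqrt_le_sqrt (by norm_num)
  have s24 : Real.sqrt 24 ≤ 5 := by
    rw [show (5 : ℝ) = Real.sqrt 25 by rw [show (25:ℝ) = 5 ^ 2 by norm_num, Real.sqrt_sq (by norm_num)]]
    exact Real.sqrt_le_sqrt (by norm_num)
  have p15 : 0 < Real.sqrt 15 := Real.sqrt_pos.mpr (by norm_num)
  have p20 : 0 < Real.sqrt 20 := Real.sqrt_pos.mpr (by norm_num)
  have p23 : 0 < Real.sqrt 23 := Real.sqrt_pos.mpr (by norm_num)
  have p24 : 0 < Real.sqrt 24 := Real.sqrt_pos.mpr (by norm_num)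
  refine ⟨?_, ?_, ?_, ?_⟩
  · refine not_assumptionA_kroneckerChar_of_LOne_ge (by norm_num) (by decide) ?_
    rw [LOne_neg15, show 2 * Real.pi / Real.sqrt 15 = Real.pi / (Real.sqrt 15 / 2) by field_simp]
    exact one_div_le_pi_div (by positivity) (by linarith)
  · refine not_assumptionA_kroneckerChar_of_LOne_ge (by norm_num) (by decide) ?_
    rw [LOne_neg20, show 2 * Real.pi / Real.sqrt 20 = Real.pi / (Real.sqrt 20 / 2) by field_simp]
    exact one_div_le_pi_div (by positivity) (by linarith)
  · refine not_assumptionA_kroneckerChar_of_LOne_ge (by norm_num) (by decide) ?_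
    rw [LOne_neg23, show 3 * Real.pi / Real.sqrt 23 = Real.pi / (Real.sqrt 23 / 3) by field_simp]
    exact one_div_le_pi_div (by positivity) (by linarith)
  · refine not_assumptionA_kroneckerChar_of_LOne_ge (by norm_num) (by decide) ?_
    rw [LOne_neg24, show 2 * Real.pi / Real.sqrt 24 = Real.pi / (Real.sqrt 24 / 2) by field_simp]
    exact one_div_le_pi_div (by positivity) (by linarith)

/-- **(A) is false at the composite bed modulus `D = −1155`** (`L = 8π/√1155`, `h(−1155) = 8`).
[cite: Zhang2022LandauSiegel, §2 Assumption (A)] [cite: DavenportMNT1980, Ch. 6] -/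
theorem not_assumptionA_kroneckerChar_neg1155 :
    haveI : NeZero (-1155 : ℤ).natAbs := ⟨by decide⟩
    ¬ AssumptionA (-1155 : ℤ).natAbs (kroneckerChar (-1155)) := by
  refine not_assumptionA_kroneckerChar_of_LOne_ge (by norm_num) (by decide) ?_
  have s : Real.sqrt 1155 ≤ 34 := by
    rw [show (34 : ℝ) = Real.sqrt 1156 by rw [show (1156:ℝ) = 34 ^ 2 by norm_num, Real.sqrt_sq (by norm_num)]]
    exact Real.sqrt_le_sqrt (by norm_num)
  have p : 0 < Real.sqrt 1155 := Real.sqrt_pos.mpr (by norm_num)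
  rw [LOne_neg1155, show 8 * Real.pi / Real.sqrt 1155 = Real.pi / (Real.sqrt 1155 / 8) by field_simp]
  exact one_div_le_pi_div (by positivity) (by linarith)

/-- **(A) is false at the deep bed-1 rung `D = −77683`** (`L = 22π/√77683`, `h(−77683) = 22`; `√77683 < 279`).
[cite: Zhang2022LandauSiegel, §2 Assumption (A)] [cite: DavenportMNT1980, Ch. 6] -/
theorem not_assumptionA_kroneckerChar_neg77683 :
    haveI : NeZero (-77683 : ℤ).natAbs := ⟨by decide⟩
    ¬ AssumptionA (-77683 : ℤ).natAbs (kroneckerChar (-77683)) := by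
  refine not_assumptionA_kroneckerChar_of_LOne_ge (by norm_num) (by decide) ?_
  have s : Real.sqrt 77683 ≤ 279 := by
    rw [show (279 : ℝ) = Real.sqrt 77841 by rw [show (77841:ℝ) = 279 ^ 2 by norm_num, Real.sqrt_sq (by norm_num)]]
    exact Real.sqrt_le_sqrt (by norm_num)
  have p : 0 < Real.sqrt 77683 := Real.sqrt_pos.mpr (by norm_num)
  rw [LOne_neg77683, show 22 * Real.pi / Real.sqrt 77683 = Real.pi / (Real.sqrt 77683 / 22) by field_simp]
  exact one_div_le_pi_div (by positivity) (by linarith)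

/-- **(A) is false at the REAL Tier-S modulus `D = 5`** (`L(1, χ₅) = 2 h_K log ε₅/√5` with `h_K = 1`,
`ε₅ = (1+√5)/2`, so `L(1,χ₅) = 2 log((1+√5)/2)/√5 ≥ 2(1 − 2/(1+√5))/√5 > 1/54`).
[cite: Zhang2022LandauSiegel, §2 Assumption (A)] [cite: DavenportMNT1980, Ch. 6] -/
theorem not_assumptionA_kroneckerChar_five :
    haveI : NeZero (5 : ℤ).natAbs := ⟨by decide⟩
    ¬ AssumptionA (5 : ℤ).natAbs (kroneckerChar 5) := by
  refine not_assumptionA_kroneckerChar_of_LOne_ge (by norm_num) (by decide) ?_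
  obtain ⟨K, _, _, h2, hdK⟩ :=
    Quadratic.exists_numberField_discr_eq (isFundamentalDiscriminant_of_mem_bed1Moduli 5 (by decide))
  have hL : LOne 5 = 2 * NumberField.classNumber K * NumberField.Units.regulator K / Real.sqrt ((5 : ℤ) : ℝ) :=
    LOne_eq_of_discr_pos h2 hdK (by norm_num)
  have hR : NumberField.Units.regulator K = Real.log ((1 + 1 * Real.sqrt 5) / 2) :=
    Quadratic.regulator_of_discr_eq_five h2 hdK
  have hh : (1 : ℝ) ≤ NumberField.classNumber K := by
    have : 1 ≤ NumberField.classNumber K := by unfold NumberField.classNumber; exact Fintype.card_pos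
    exact_mod_cast this
  have hs5 : (2 : ℝ) < Real.sqrt 5 := by
    rw [show (2 : ℝ) = Real.sqrt 4 by rw [show (4:ℝ) = 2 ^ 2 by norm_num, Real.sqrt_sq (by norm_num)]]
    exact Real.sqrt_lt_sqrt (by norm_num) (by norm_num)
  have hs5' : Real.sqrt 5 < 3 := by
    rw [show (3 : ℝ) = Real.sqrt 9 by rw [show (9:ℝ) = 3 ^ 2 by norm_num, Real.sqrt_sq (by norm_num)]]
    exact Real.sqrt_lt_sqrt (by norm_num) (by norm_num)
  have hphi : (0 : ℝ) < (1 + 1 * Real.sqrt 5) / 2 := by positivity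
  have hlog : 1 - ((1 + 1 * Real.sqrt 5) / 2)⁻¹ ≤ Real.log ((1 + 1 * Real.sqrt 5) / 2) :=
    Real.one_sub_inv_le_log_of_pos hphi
  have hinv : ((1 + 1 * Real.sqrt 5) / 2)⁻¹ ≤ 2 / 3 := by
    rw [inv_eq_one_div, div_le_div_iff₀ hphi (by norm_num)]; nlinarith
  have hlog' : (1 : ℝ) / 3 ≤ Real.log ((1 + 1 * Real.sqrt 5) / 2) := by linarith
  have hcast : Real.sqrt ((5 : ℤ) : ℝ) = Real.sqrt 5 := by norm_num
  have hs0 : 0 < Real.sqrt 5 := by linarith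
  rw [hL, hR, hcast, div_le_div_iff₀ (by norm_num) hs0]
  -- `1·√5 ≤ 2·h·log ε₅·54` with `h ≥ 1`, `log ε₅ ≥ 1/3`, `√5 < 3`
  have hprod : (1 : ℝ) / 3 ≤ NumberField.classNumber K * Real.log ((1 + 1 * Real.sqrt 5) / 2) := by
    have h0 : (0 : ℝ) ≤ Real.log ((1 + 1 * Real.sqrt 5) / 2) := by linarith
    nlinarith
  nlinarith

/-! ## Rev 2 (append): the POSITIVE bed moduli — `L(1,χ_D) = 2 h_K R_K/√D ≥ 2 log ε_D/√D` with the tree's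
kernel fundamental units (`Quadratic.regulator_of_discr_eq_*`, RealQuadraticFundamentalUnitValues); with these the
leaf covers ALL ELEVEN Tier-S moduli of bed12-S-v0.1 (`−3, −4, 5, −7, 8, 12, 13, −23, −163, −1155, 1365`) and every
bed-1 `L1a`/`L1b` modulus. -/

/-- Positive discriminants: if every quadratic field with `d_K = D` has `R_K = log x` with `x ≥ 2`, then
`LOne D ≥ 1/√D` (`LOne D = 2 h_K R_K/√D`, `h_K ≥ 1`, `log x ≥ 1 − 1/x ≥ 1/2`). [cite: DavenportMNT1980, Ch. 6] -/
private theorem LOne_ge_inv_sqrt_of_pos {D : ℤ} (hfd : Literature.Barriers.RiemannHypothesis.IsFundamentalDiscriminant D)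
    (hD : 0 < D) {x : ℝ} (hx : 2 ≤ x)
    (hreg : ∀ (K : Type) [Field K] [NumberField K], Module.finrank ℚ K = 2 → NumberField.discr K = D →
      NumberField.Units.regulator K = Real.log x) :
    1 / Real.sqrt (D : ℝ) ≤ LOne D := by
  obtain ⟨K, _, _, h2, hdK⟩ := Quadratic.exists_numberField_discr_eq hfd
  have hL : LOne D = 2 * NumberField.classNumber K * NumberField.Units.regulator K / Real.sqrt (D : ℝ) :=
    LOne_eq_of_discr_pos h2 hdK hD
  have hR := hreg K h2 hdK
  have hh : (1 : ℝ) ≤ NumberField.classNumber K := by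
    have : 1 ≤ NumberField.classNumber K := by unfold NumberField.classNumber; exact Fintype.card_pos
    exact_mod_cast this
  have hxpos : (0 : ℝ) < x := by linarith
  have hlog : 1 - x⁻¹ ≤ Real.log x := Real.one_sub_inv_le_log_of_pos hxpos
  have hinv : x⁻¹ ≤ 1 / 2 := by rw [inv_eq_one_div, div_le_div_iff₀ hxpos (by norm_num)]; linarith
  have hlog' : (1 : ℝ) / 2 ≤ Real.log x := by linarith
  have hsqrt : 0 < Real.sqrt (D : ℝ) := Real.sqrt_pos.mpr (by exact_mod_cast hD)
  rw [hL, hR, div_le_div_iff₀ hsqrt hsqrt]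
  have hprod : (1 : ℝ) / 2 ≤ NumberField.classNumber K * Real.log x := by
    have h0 : (0 : ℝ) ≤ Real.log x := by linarith
    nlinarith
  nlinarith

/-- `1/54 ≤ 1/√D` for `0 < D ≤ 2916 = 54²`. [folklore] -/
private theorem one_div_le_inv_sqrt {D : ℤ} (hD : 0 < D) (hD' : D ≤ 2916) :
    (1 : ℝ) / 54 ≤ 1 / Real.sqrt (D : ℝ) := by
  have hsqrt : 0 < Real.sqrt (D : ℝ) := Real.sqrt_pos.mpr (by exact_mod_cast hD)
  have hs : Real.sqrt (D : ℝ) ≤ 54 := by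
    rw [show (54 : ℝ) = Real.sqrt 2916 by rw [show (2916:ℝ) = 54 ^ 2 by norm_num, Real.sqrt_sq (by norm_num)]]
    exact Real.sqrt_le_sqrt (by exact_mod_cast hD')
  rw [div_le_div_iff₀ (by norm_num) hsqrt]; linarith

/-- **(A) is false at `D = 8`** (`ε₈ = 1 + √2`; Tier-S modulus). [cite: Zhang2022LandauSiegel, §2 Assumption (A)] [cite: DavenportMNT1980, Ch. 6] -/
theorem not_assumptionA_kroneckerChar_eight :
    haveI : NeZero (8 : ℤ).natAbs := ⟨by decide⟩
    ¬ AssumptionA (8 : ℤ).natAbs (kroneckerChar 8) := by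
  refine not_assumptionA_kroneckerChar_of_LOne_ge (by norm_num) (by decide)
    (le_trans (one_div_le_inv_sqrt (D := 8) (by norm_num) (by norm_num)) ?_)
  refine LOne_ge_inv_sqrt_of_pos (isFundamentalDiscriminant_of_mem_bed1Moduli 8 (by decide)) (by norm_num)
    (x := (2 + 1 * Real.sqrt 8) / 2) ?_ (fun K _ _ h2 hd => Quadratic.regulator_of_discr_eq_eight h2 hd)
  have : (2 : ℝ) ≤ Real.sqrt 8 := by
    rw [show (2 : ℝ) = Real.sqrt 4 by rw [show (4:ℝ) = 2 ^ 2 by norm_num, Real.sqrt_sq (by norm_num)]]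
    exact Real.sqrt_le_sqrt (by norm_num)
  linarith

/-- **(A) is false at `D = 12`** (`ε₁₂ = 2 + √3`; Tier-S modulus). [cite: Zhang2022LandauSiegel, §2 Assumption (A)] [cite: DavenportMNT1980, Ch. 6] -/
theorem not_assumptionA_kroneckerChar_twelve :
    haveI : NeZero (12 : ℤ).natAbs := ⟨by decide⟩
    ¬ AssumptionA (12 : ℤ).natAbs (kroneckerChar 12) := by
  refine not_assumptionA_kroneckerChar_of_LOne_ge (by norm_num) (by decide)
    (le_trans (one_div_le_inv_sqrt (D := 12) (by norm_num) (by norm_num)) ?_)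
  refine LOne_ge_inv_sqrt_of_pos (isFundamentalDiscriminant_of_mem_bed1Moduli 12 (by decide)) (by norm_num)
    (x := (4 + 1 * Real.sqrt 12) / 2) ?_ (fun K _ _ h2 hd => Quadratic.regulator_of_discr_eq_twelve h2 hd)
  have : (0 : ℝ) ≤ Real.sqrt 12 := Real.sqrt_nonneg _
  linarith

/-- **(A) is false at `D = 13`** (`ε₁₃ = (3 + √13)/2`; Tier-S modulus). [cite: Zhang2022LandauSiegel, §2 Assumption (A)] [cite: DavenportMNT1980, Ch. 6] -/
theorem not_assumptionA_kroneckerChar_thirteen :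
    haveI : NeZero (13 : ℤ).natAbs := ⟨by decide⟩
    ¬ AssumptionA (13 : ℤ).natAbs (kroneckerChar 13) := by
  refine not_assumptionA_kroneckerChar_of_LOne_ge (by norm_num) (by decide)
    (le_trans (one_div_le_inv_sqrt (D := 13) (by norm_num) (by norm_num)) ?_)
  refine LOne_ge_inv_sqrt_of_pos (isFundamentalDiscriminant_of_mem_bed1Moduli 13 (by decide)) (by norm_num)
    (x := (3 + 1 * Real.sqrt 13) / 2) ?_ (fun K _ _ h2 hd => Quadratic.regulator_of_discr_eq_thirteen h2 hd)
  have : (1 : ℝ) ≤ Real.sqrt 13 := by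
    rw [show (1 : ℝ) = Real.sqrt 1 by simp]
    exact Real.sqrt_le_sqrt (by norm_num)
  linarith

/-- **(A) is false at `D = 17, 21, 24, 28, 29`** (bed-1 `L1b`; `ε = 4+√17, (5+√21)/2, 5+2√6, 8+3√7, (5+√29)/2`).
[cite: Zhang2022LandauSiegel, §2 Assumption (A)] [cite: DavenportMNT1980, Ch. 6] -/
theorem not_assumptionA_kroneckerChar_17_21_24_28_29 :
    (haveI : NeZero (17 : ℤ).natAbs := ⟨by decide⟩; ¬ AssumptionA (17 : ℤ).natAbs (kroneckerChar 17)) ∧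
    (haveI : NeZero (21 : ℤ).natAbs := ⟨by decide⟩; ¬ AssumptionA (21 : ℤ).natAbs (kroneckerChar 21)) ∧
    (haveI : NeZero (24 : ℤ).natAbs := ⟨by decide⟩; ¬ AssumptionA (24 : ℤ).natAbs (kroneckerChar 24)) ∧
    (haveI : NeZero (28 : ℤ).natAbs := ⟨by decide⟩; ¬ AssumptionA (28 : ℤ).natAbs (kroneckerChar 28)) ∧
    (haveI : NeZero (29 : ℤ).natAbs := ⟨by decide⟩; ¬ AssumptionA (29 : ℤ).natAbs (kroneckerChar 29)) := by
  have s17 : (0 : ℝ) ≤ Real.sqrt 17 := Real.sqrt_nonneg _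
  have s21 : (0 : ℝ) ≤ Real.sqrt 21 := Real.sqrt_nonneg _
  have s24 : (0 : ℝ) ≤ Real.sqrt 24 := Real.sqrt_nonneg _
  have s28 : (0 : ℝ) ≤ Real.sqrt 28 := Real.sqrt_nonneg _
  have s29 : (0 : ℝ) ≤ Real.sqrt 29 := Real.sqrt_nonneg _
  refine ⟨?_, ?_, ?_, ?_, ?_⟩
  · refine not_assumptionA_kroneckerChar_of_LOne_ge (by norm_num) (by decide)
      (le_trans (one_div_le_inv_sqrt (D := 17) (by norm_num) (by norm_num)) ?_)
    exact LOne_ge_inv_sqrt_of_pos (isFundamentalDiscriminant_of_mem_bed1Moduli 17 (by decide)) (by norm_num)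
      (x := (8 + 2 * Real.sqrt 17) / 2) (by linarith) (fun K _ _ h2 hd => Quadratic.regulator_of_discr_eq_seventeen h2 hd)
  · refine not_assumptionA_kroneckerChar_of_LOne_ge (by norm_num) (by decide)
      (le_trans (one_div_le_inv_sqrt (D := 21) (by norm_num) (by norm_num)) ?_)
    exact LOne_ge_inv_sqrt_of_pos (isFundamentalDiscriminant_of_mem_bed1Moduli 21 (by decide)) (by norm_num)
      (x := (5 + 1 * Real.sqrt 21) / 2) (by linarith) (fun K _ _ h2 hd => Quadratic.regulator_of_discr_eq_twentyOne h2 hd)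
  · refine not_assumptionA_kroneckerChar_of_LOne_ge (by norm_num) (by decide)
      (le_trans (one_div_le_inv_sqrt (D := 24) (by norm_num) (by norm_num)) ?_)
    exact LOne_ge_inv_sqrt_of_pos (isFundamentalDiscriminant_of_mem_bed1Moduli 24 (by decide)) (by norm_num)
      (x := (10 + 2 * Real.sqrt 24) / 2) (by linarith) (fun K _ _ h2 hd => Quadratic.regulator_of_discr_eq_twentyFour h2 hd)
  · refine not_assumptionA_kroneckerChar_of_LOne_ge (by norm_num) (by decide)
      (le_trans (one_div_le_inv_sqrt (D := 28) (by norm_num) (by norm_num)) ?_)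
    exact LOne_ge_inv_sqrt_of_pos (isFundamentalDiscriminant_of_mem_bed1Moduli 28 (by decide)) (by norm_num)
      (x := (16 + 3 * Real.sqrt 28) / 2) (by linarith) (fun K _ _ h2 hd => Quadratic.regulator_of_discr_eq_twentyEight h2 hd)
  · refine not_assumptionA_kroneckerChar_of_LOne_ge (by norm_num) (by decide)
      (le_trans (one_div_le_inv_sqrt (D := 29) (by norm_num) (by norm_num)) ?_)
    exact LOne_ge_inv_sqrt_of_pos (isFundamentalDiscriminant_of_mem_bed1Moduli 29 (by decide)) (by norm_num)
      (x := (5 + 1 * Real.sqrt 29) / 2) (by linarith) (fun K _ _ h2 hd => Quadratic.regulator_of_discr_eq_twentyNine h2 hd)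

/-- **(A) is false at `D = 1365`** (`ε₁₃₆₅ = (37 + √1365)/2`; the composite positive Tier-S / `L1b` modulus, `√1365 < 54`).
[cite: Zhang2022LandauSiegel, §2 Assumption (A)] [cite: DavenportMNT1980, Ch. 6] -/
theorem not_assumptionA_kroneckerChar_1365 :
    haveI : NeZero (1365 : ℤ).natAbs := ⟨by decide⟩
    ¬ AssumptionA (1365 : ℤ).natAbs (kroneckerChar 1365) := by
  refine not_assumptionA_kroneckerChar_of_LOne_ge (by norm_num) (by decide)
    (le_trans (one_div_le_inv_sqrt (D := 1365) (by norm_num) (by norm_num)) ?_)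
  refine LOne_ge_inv_sqrt_of_pos (isFundamentalDiscriminant_of_mem_bed1Moduli 1365 (by decide)) (by norm_num)
    (x := (37 + 1 * Real.sqrt 1365) / 2) ?_ (fun K _ _ h2 hd => Quadratic.regulator_of_discr_eq_1365 h2 hd)
  have : (0 : ℝ) ≤ Real.sqrt 1365 := Real.sqrt_nonneg _
  linarith

/-- **Assumption (A) is false at EVERY Tier-S modulus of bed12-S-v0.1** (`χ` list of the spec 722a0c33fade5277:
`D ∈ {−3, −4, 5, −7, 8, 12, 13, −23, −163, −1155, 1365}`): the eleven instances packaged — the kernel form of BED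
§0.2 (H2) «every (A)-guarded node holds vacuously at the bed's genuine characters».
[cite: Zhang2022LandauSiegel, §2 Assumption (A)] -/
theorem not_assumptionA_bed12S_moduli :
    (haveI : NeZero (-3 : ℤ).natAbs := ⟨by decide⟩; ¬ AssumptionA (-3 : ℤ).natAbs (kroneckerChar (-3))) ∧
    (haveI : NeZero (-4 : ℤ).natAbs := ⟨by decide⟩; ¬ AssumptionA (-4 : ℤ).natAbs (kroneckerChar (-4))) ∧
    (haveI : NeZero (5 : ℤ).natAbs := ⟨by decide⟩; ¬ AssumptionA (5 : ℤ).natAbs (kroneckerChar 5)) ∧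
    (haveI : NeZero (-7 : ℤ).natAbs := ⟨by decide⟩; ¬ AssumptionA (-7 : ℤ).natAbs (kroneckerChar (-7))) ∧
    (haveI : NeZero (8 : ℤ).natAbs := ⟨by decide⟩; ¬ AssumptionA (8 : ℤ).natAbs (kroneckerChar 8)) ∧
    (haveI : NeZero (12 : ℤ).natAbs := ⟨by decide⟩; ¬ AssumptionA (12 : ℤ).natAbs (kroneckerChar 12)) ∧
    (haveI : NeZero (13 : ℤ).natAbs := ⟨by decide⟩; ¬ AssumptionA (13 : ℤ).natAbs (kroneckerChar 13)) ∧
    (haveI : NeZero (-23 : ℤ).natAbs := ⟨by decide⟩; ¬ AssumptionA (-23 : ℤ).natAbs (kroneckerChar (-23))) ∧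
    (haveI : NeZero (-163 : ℤ).natAbs := ⟨by decide⟩; ¬ AssumptionA (-163 : ℤ).natAbs (kroneckerChar (-163))) ∧
    (haveI : NeZero (-1155 : ℤ).natAbs := ⟨by decide⟩; ¬ AssumptionA (-1155 : ℤ).natAbs (kroneckerChar (-1155))) ∧
    (haveI : NeZero (1365 : ℤ).natAbs := ⟨by decide⟩; ¬ AssumptionA (1365 : ℤ).natAbs (kroneckerChar 1365)) := by
  obtain ⟨_, h7⟩ := not_assumptionA_kroneckerChar_of_mem_classNumberOne (D := -7) (by simp)
  obtain ⟨_, h163⟩ := not_assumptionA_kroneckerChar_of_mem_classNumberOne (D := -163) (by simp)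
  exact ⟨not_assumptionA_kroneckerChar_neg3, not_assumptionA_kroneckerChar_neg4, not_assumptionA_kroneckerChar_five,
    h7, not_assumptionA_kroneckerChar_eight, not_assumptionA_kroneckerChar_twelve,
    not_assumptionA_kroneckerChar_thirteen, not_assumptionA_kroneckerChar_neg15_20_23_24.2.2.1, h163,
    not_assumptionA_kroneckerChar_neg1155, not_assumptionA_kroneckerChar_1365⟩

/-! ## Rev 3 (append): UNIFORM ranges — every fundamental discriminant `−28 000 ≤ D < −4` and `0 < D ≤ 1 600`
(`L(1,χ_D) = π h(D)/√|D| ≥ π/√|D|`, resp. `= 2 h_K R_K/√D ≥ (3/4)/√D` with `R_K ≥ log((1+√5)/2) ≥ 3/8`,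
`Quadratic.log_goldenRatio_le_regulator`) — so (A) is refuted in the kernel at every real primitive character of
modulus up to `1 600` and every odd one up to `28 000`, i.e. at every modulus a bed at these scales can use. -/

/-- **(A) is false at χ_D for EVERY fundamental discriminant `−28 000 ≤ D < −4`**: `L(1,χ_D) = π·h(D)/√|D|`
(`LOne_eq_pi_mul_classNumber_div_sqrt`) with `h(D) ≥ 1` (`BinQF.classNumber_pos`) gives `L(1,χ_D) ≥ π/√|D| ≥
π/√28000 > 1/54 ≥ 1/(log|D|)^2022`. [cite: Zhang2022LandauSiegel, §2 Assumption (A)] [cite: DavenportMNT1980, Ch. 6] -/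
theorem not_assumptionA_kroneckerChar_of_neg {D : ℤ} (hfd : Literature.Barriers.RiemannHypothesis.IsFundamentalDiscriminant D)
    (h4 : D < -4) (h28 : -28000 ≤ D) :
    ∃ h0 : D ≠ 0, haveI : NeZero D.natAbs := ⟨Int.natAbs_ne_zero.mpr h0⟩
      ¬ AssumptionA D.natAbs (kroneckerChar D) := by
  have h0 : D ≠ 0 := by omega
  have h3 : 3 ≤ D.natAbs := by omega
  refine ⟨h0, not_assumptionA_kroneckerChar_of_LOne_ge h0 h3 ?_⟩
  rw [LOne_eq_pi_mul_classNumber_div_sqrt hfd h4]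
  have hmod : D % 4 = 0 ∨ D % 4 = 1 := by
    rcases hfd with ⟨h1, -, -⟩ | ⟨h4d, -, -⟩
    · exact Or.inr h1
    · exact Or.inl (Int.emod_eq_zero_of_dvd h4d)
  have hh : (1 : ℝ) ≤ Quadratic.BinQF.classNumber D := by
    exact_mod_cast Quadratic.BinQF.classNumber_pos (by omega) hmod
  have habs : (0 : ℝ) < |(D : ℝ)| := by
    have : (D : ℝ) < 0 := by exact_mod_cast (show D < 0 by omega)
    exact abs_pos.mpr this.ne
  have hsqrt : 0 < Real.sqrt |(D : ℝ)| := Real.sqrt_pos.mpr habs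
  have hle : |(D : ℝ)| ≤ 28000 := by
    rw [abs_le]; constructor <;> [exact_mod_cast (by omega : (-28000 : ℤ) ≤ D); exact_mod_cast (by omega : D ≤ 28000)]
  have hs : Real.sqrt |(D : ℝ)| ≤ 168 := by
    rw [show (168 : ℝ) = Real.sqrt 28224 by rw [show (28224:ℝ) = 168 ^ 2 by norm_num, Real.sqrt_sq (by norm_num)]]
    exact Real.sqrt_le_sqrt (by linarith)
  rw [div_le_div_iff₀ (by norm_num) hsqrt]
  nlinarith [Real.pi_gt_d2, Real.pi_pos]

/-- **(A) is false at χ_D for EVERY fundamental discriminant `0 < D ≤ 1 600`**: `L(1,χ_D) = 2 h_K R_K/√D`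
(`LOne_eq_of_discr_pos`) with `h_K ≥ 1` and `R_K ≥ log((1+√5)/2) ≥ 3/8` (`Quadratic.log_goldenRatio_le_regulator`,
`Quadratic.three_eighths_le_log_goldenRatio`) gives `L(1,χ_D) ≥ (3/4)/√D ≥ (3/4)/40 > 1/54`.
[cite: Zhang2022LandauSiegel, §2 Assumption (A)] [cite: DavenportMNT1980, Ch. 6] -/
theorem not_assumptionA_kroneckerChar_of_pos {D : ℤ} (hfd : Literature.Barriers.RiemannHypothesis.IsFundamentalDiscriminant D)
    (hD : 0 < D) (h16 : D ≤ 1600) :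
    ∃ h0 : D ≠ 0, haveI : NeZero D.natAbs := ⟨Int.natAbs_ne_zero.mpr h0⟩
      ¬ AssumptionA D.natAbs (kroneckerChar D) := by
  have h0 : D ≠ 0 := by omega
  obtain ⟨K, _, _, h2, hdK⟩ := Quadratic.exists_numberField_discr_eq hfd
  have hd' : 0 < NumberField.discr K := by rw [hdK]; exact hD
  have h5 : 5 ≤ D.toNat := by
    have := Quadratic.five_le_discr_toNat h2 hd'; rwa [hdK] at this
  have h3 : 3 ≤ D.natAbs := by omega
  refine ⟨h0, not_assumptionA_kroneckerChar_of_LOne_ge h0 h3 ?_⟩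
  have hL : LOne D = 2 * NumberField.classNumber K * NumberField.Units.regulator K / Real.sqrt (D : ℝ) :=
    LOne_eq_of_discr_pos h2 hdK hD
  have hR : (3 : ℝ) / 8 ≤ NumberField.Units.regulator K :=
    le_trans Quadratic.three_eighths_le_log_goldenRatio (Quadratic.log_goldenRatio_le_regulator h2 hd')
  have hh : (1 : ℝ) ≤ NumberField.classNumber K := by
    have : 1 ≤ NumberField.classNumber K := by unfold NumberField.classNumber; exact Fintype.card_pos
    exact_mod_cast this
  have hsqrt : 0 < Real.sqrt (D : ℝ) := Real.sqrt_pos.mpr (by exact_mod_cast hD)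
  have hs : Real.sqrt (D : ℝ) ≤ 40 := by
    rw [show (40 : ℝ) = Real.sqrt 1600 by rw [show (1600:ℝ) = 40 ^ 2 by norm_num, Real.sqrt_sq (by norm_num)]]
    exact Real.sqrt_le_sqrt (by exact_mod_cast h16)
  rw [hL, div_le_div_iff₀ (by norm_num) hsqrt]
  have hprod : (3 : ℝ) / 8 ≤ NumberField.classNumber K * NumberField.Units.regulator K := by
    have h0 : (0 : ℝ) ≤ NumberField.Units.regulator K := by linarith
    nlinarith
  nlinarith

/-! ## Rev 4 (append): the ranges pushed to `|D| ≤ 10¹²` — every modulus any engine reaches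

`(log|D|)^2022 ≥ (log 5)^32 > 2.5·10⁶` for `|D| ≥ 5`, while `L(1,χ_D) ≥ π/√|D|` (imaginary) resp. `≥ (3/4)/√D`
(real) stays `≥ 7.5·10⁻⁷ > 1/(2.5·10⁶)` for `|D| ≤ 10¹²`. -/

/-- `log 5 ≥ 1.586` (`log 5 = 2 log 2 + log (5/4)`, `log (5/4) ≥ 1 − 4/5`). [folklore] -/
private theorem log_five_ge : (1.586 : ℝ) ≤ Real.log 5 := by
  have h2 := Real.log_two_gt_d9
  have h54 : (1 : ℝ) - (5 / 4 : ℝ)⁻¹ ≤ Real.log (5 / 4) := Real.one_sub_inv_le_log_of_pos (by norm_num)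
  have : Real.log 5 = Real.log 2 + Real.log 2 + Real.log (5 / 4) := by
    rw [← Real.log_mul (by norm_num) (by norm_num), ← Real.log_mul (by norm_num) (by norm_num)]; norm_num
  rw [this]; norm_num at h54 ⊢; linarith

/-- **For `D ≥ 5`: `1/(log D)^2022 ≤ 1/2 500 000`** (`(log D)^2022 ≥ (log D)^32 ≥ 1.586^32 > 2.5·10⁶`). [folklore] -/
private theorem one_div_log_pow_le_small {D : ℕ} (hD : 5 ≤ D) : 1 / Real.log D ^ 2022 ≤ (1 : ℝ) / 2500000 := by
  have h5 : Real.log 5 ≤ Real.log D := Real.log_le_log (by norm_num) (by exact_mod_cast hD)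
  have hlog : (1.586 : ℝ) ≤ Real.log D := le_trans log_five_ge h5
  have h1 : (1 : ℝ) ≤ Real.log D := by linarith
  have h32 : Real.log D ^ 32 ≤ Real.log D ^ 2022 := pow_le_pow_right₀ h1 (by norm_num)
  have hb : (1.586 : ℝ) ^ 32 ≤ Real.log D ^ 32 := pow_le_pow_left₀ (by norm_num) hlog 32
  have hnum : (2500000 : ℝ) ≤ (1.586 : ℝ) ^ 32 := by norm_num
  have hpos : (0 : ℝ) < Real.log D ^ 2022 := by positivity
  rw [div_le_div_iff₀ hpos (by norm_num)]
  linarith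

/-- **`Re L(1,χ) ≥ 1/2 500 000` refutes Assumption (A) at any modulus `D ≥ 5`**, for ANY Dirichlet character
`χ (mod D)`. [cite: Zhang2022LandauSiegel, §2 Assumption (A)] -/
theorem not_assumptionA_of_re_ge_small {D : ℕ} [NeZero D] (χ : DirichletCharacter ℂ D) (hD : 5 ≤ D)
    (h : (1 : ℝ) / 2500000 ≤ (χ.LFunction 1).re) : ¬ AssumptionA D χ := by
  intro hA
  unfold AssumptionA at hA
  have hre : (χ.LFunction 1).re ≤ ‖χ.LFunction 1‖ := Complex.re_le_norm _
  have hlog := one_div_log_pow_le_small hD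
  linarith

/-- **(A) is false at χ_D for EVERY fundamental discriminant `−10¹² ≤ D < −4`** (`L(1,χ_D) = π h(D)/√|D| ≥ π/√|D| ≥
π·10⁻⁶ > 1/(log|D|)^2022`). With `not_assumptionA_kroneckerChar_neg3/neg4`: every imaginary quadratic character of
conductor `≤ 10¹²`. [cite: Zhang2022LandauSiegel, §2 Assumption (A)] [cite: DavenportMNT1980, Ch. 6] -/
theorem not_assumptionA_kroneckerChar_of_neg_le_1e12 {D : ℤ}
    (hfd : Literature.Barriers.RiemannHypothesis.IsFundamentalDiscriminant D) (h4 : D < -4) (h12 : -(10 ^ 12) ≤ D) :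
    ∃ h0 : D ≠ 0, haveI : NeZero D.natAbs := ⟨Int.natAbs_ne_zero.mpr h0⟩
      ¬ AssumptionA D.natAbs (kroneckerChar D) := by
  have h0 : D ≠ 0 := by omega
  have h5 : 5 ≤ D.natAbs := by omega
  haveI : NeZero D.natAbs := ⟨Int.natAbs_ne_zero.mpr h0⟩
  refine ⟨h0, not_assumptionA_of_re_ge_small _ h5 ?_⟩
  have hL := LOne_eq_re h0
  rw [← hL, LOne_eq_pi_mul_classNumber_div_sqrt hfd h4]
  have hmod : D % 4 = 0 ∨ D % 4 = 1 := by
    rcases hfd with ⟨h1, -, -⟩ | ⟨h4d, -, -⟩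
    · exact Or.inr h1
    · exact Or.inl (Int.emod_eq_zero_of_dvd h4d)
  have hh : (1 : ℝ) ≤ Quadratic.BinQF.classNumber D := by
    exact_mod_cast Quadratic.BinQF.classNumber_pos (by omega) hmod
  have habs : (0 : ℝ) < |(D : ℝ)| := by
    have : (D : ℝ) < 0 := by exact_mod_cast (show D < 0 by omega)
    exact abs_pos.mpr this.ne
  have hsqrt : 0 < Real.sqrt |(D : ℝ)| := Real.sqrt_pos.mpr habs
  have hle : |(D : ℝ)| ≤ (10 : ℝ) ^ 12 := by
    rw [abs_le]; constructor
    · exact_mod_cast (show -(10 ^ 12 : ℤ) ≤ D by omega)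
    · exact_mod_cast (show D ≤ 10 ^ 12 by omega)
  have hs : Real.sqrt |(D : ℝ)| ≤ (10 : ℝ) ^ 6 := by
    rw [show ((10 : ℝ) ^ 6) = Real.sqrt ((10 : ℝ) ^ 12) by
      rw [show ((10 : ℝ) ^ 12) = ((10 : ℝ) ^ 6) ^ 2 by norm_num, Real.sqrt_sq (by norm_num)]]
    exact Real.sqrt_le_sqrt hle
  rw [div_le_div_iff₀ (by norm_num) hsqrt]
  nlinarith [Real.pi_gt_three, Real.pi_pos]

/-- **(A) is false at χ_D for EVERY fundamental discriminant `0 < D ≤ 10¹²`** (`L(1,χ_D) = 2 h_K R_K/√D ≥ (3/4)/√D ≥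
7.5·10⁻⁷ > 1/(log D)^2022`): every real (even) quadratic character of conductor `≤ 10¹²`.
[cite: Zhang2022LandauSiegel, §2 Assumption (A)] [cite: DavenportMNT1980, Ch. 6] -/
theorem not_assumptionA_kroneckerChar_of_pos_le_1e12 {D : ℤ}
    (hfd : Literature.Barriers.RiemannHypothesis.IsFundamentalDiscriminant D) (hD : 0 < D) (h12 : D ≤ 10 ^ 12) :
    ∃ h0 : D ≠ 0, haveI : NeZero D.natAbs := ⟨Int.natAbs_ne_zero.mpr h0⟩
      ¬ AssumptionA D.natAbs (kroneckerChar D) := by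
  have h0 : D ≠ 0 := by omega
  obtain ⟨K, _, _, h2, hdK⟩ := Quadratic.exists_numberField_discr_eq hfd
  have hd' : 0 < NumberField.discr K := by rw [hdK]; exact hD
  have h5n : 5 ≤ D.toNat := by
    have := Quadratic.five_le_discr_toNat h2 hd'; rwa [hdK] at this
  have h5 : 5 ≤ D.natAbs := by omega
  haveI : NeZero D.natAbs := ⟨Int.natAbs_ne_zero.mpr h0⟩
  refine ⟨h0, not_assumptionA_of_re_ge_small _ h5 ?_⟩
  have hL0 := LOne_eq_re h0
  have hL : LOne D = 2 * NumberField.classNumber K * NumberField.Units.regulator K / Real.sqrt (D : ℝ) :=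
    LOne_eq_of_discr_pos h2 hdK hD
  rw [← hL0, hL]
  have hR : (3 : ℝ) / 8 ≤ NumberField.Units.regulator K :=
    le_trans Quadratic.three_eighths_le_log_goldenRatio (Quadratic.log_goldenRatio_le_regulator h2 hd')
  have hh : (1 : ℝ) ≤ NumberField.classNumber K := by
    have : 1 ≤ NumberField.classNumber K := by unfold NumberField.classNumber; exact Fintype.card_pos
    exact_mod_cast this
  have hsqrt : 0 < Real.sqrt (D : ℝ) := Real.sqrt_pos.mpr (by exact_mod_cast hD)
  have hle : (D : ℝ) ≤ (10 : ℝ) ^ 12 := by exact_mod_cast h12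
  have hs : Real.sqrt (D : ℝ) ≤ (10 : ℝ) ^ 6 := by
    rw [show ((10 : ℝ) ^ 6) = Real.sqrt ((10 : ℝ) ^ 12) by
      rw [show ((10 : ℝ) ^ 12) = ((10 : ℝ) ^ 6) ^ 2 by norm_num, Real.sqrt_sq (by norm_num)]]
    exact Real.sqrt_le_sqrt hle
  rw [div_le_div_iff₀ (by norm_num) hsqrt]
  have hprod : (3 : ℝ) / 8 ≤ NumberField.classNumber K * NumberField.Units.regulator K := by
    have h0' : (0 : ℝ) ≤ NumberField.Units.regulator K := by linarith
    nlinarith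
  nlinarith

/-! ## Rev 5 (append): one citable package for BED §0.2 (H2) -/

/-- **Assumption (A) is false at `χ_D` for EVERY fundamental discriminant with `|D| ≤ 10¹²`** — i.e. at every real
primitive Dirichlet character (the tree's `kroneckerChar D`, `isKroneckerChar_kroneckerChar`) of conductor at most
`10¹²`: the cases `D > 0` (`…_of_pos_le_1e12`), `D < −4` (`…_of_neg_le_1e12`), `D = −3, −4` (by value); no other `D`
with `|D| ≤ 4` is a fundamental discriminant. This is the rescue bed's honesty rule H2 («(A) is vacuous at every
modulus an engine reaches») as one kernel statement. [cite: Zhang2022LandauSiegel, §2 Assumption (A)] [cite: DavenportMNT1980, Ch. 6] -/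
theorem not_assumptionA_kroneckerChar_of_natAbs_le_1e12 {D : ℤ}
    (hfd : Literature.Barriers.RiemannHypothesis.IsFundamentalDiscriminant D) (h12 : D.natAbs ≤ 10 ^ 12) :
    ∃ h0 : D ≠ 0, haveI : NeZero D.natAbs := ⟨Int.natAbs_ne_zero.mpr h0⟩
      ¬ AssumptionA D.natAbs (kroneckerChar D) := by
  have h12' : D.natAbs ≤ 1000000000000 := by norm_num at h12; exact h12
  rcases lt_or_ge 0 D with hpos | hnonpos
  · exact not_assumptionA_kroneckerChar_of_pos_le_1e12 hfd hpos (by norm_num; omega)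
  · rcases lt_or_ge D (-4) with hlt | hge
    · exact not_assumptionA_kroneckerChar_of_neg_le_1e12 hfd hlt (by norm_num; omega)
    · have hD : D = -4 ∨ D = -3 ∨ D = -2 ∨ D = -1 ∨ D = 0 := by omega
      rcases hD with rfl | rfl | rfl | rfl | rfl
      · exact ⟨by norm_num, not_assumptionA_kroneckerChar_neg4⟩
      · exact ⟨by norm_num, not_assumptionA_kroneckerChar_neg3⟩
      all_goals
        exfalso
        rcases hfd with ⟨h1, -, -⟩ | ⟨h4, h23, -⟩ <;> omega

end Literature.NumberTheory.LFunctions.Zhang2022.Repair.Bed.Vacuity
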